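/-
Copyright (c) 2026. All rights reserved.
Released under Apache 2.0 license as described in the file LICENSE.
Authors: abc-iut cell, seat abc-iut-w6-d109 (gen 2).
-/
import Literature.GroupTheory.TwistedCommutatorWidthAbsorb

/-!
# Twisted commutator width: the top layer, the inductive step, and the width theorem

Third file of the relative Serre argument (`TwistedCommutatorWidth.lean`,
`TwistedCommutatorWidthAbsorb.lean`).  With `W := T(l, Q) · T(m, Q) · {y ^ q | y ∈ Q}` and
`A := ⁅Q, U⁆ ⊔ ⟨{y ^ q | y ∈ Q}⟩` (an ABSTRACT subgroup):

* `commutator_sup_powClosure_subset_wordSet_mul_of_le` (TOP LAYER) — `A ⊆ W · N₁` whenever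
  `⁅Q, Q⁆ ≤ N₁ ∋ y ^ q` (`y ∈ Q`);
* `wordSet_mul_subset_wordSet_mul` (STEP) — `W · K₁ ⊆ W · N` for a layer `K₁ / N` central in `Q`
  with `K₁ ≤ ⁅K₂, Q⁆ ⊔ ⟨K₂ ^ q⟩`, `⁅m, K₂⁆ ⊆ K₁`;
* `normal_closure_pow_image`, `lowerPowSeries_le`, `lowerPowSeries_normal` — bookkeeping for a
  sequence `D 0 = Q`, `D (j+1) = ⁅D j, Q⁆ ⊔ ⟨(D j) ^ q⟩` (the lower `q`-central series, as a hypothesis);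
* `commutator_sup_powClosure_subset_wordSet_mul` (WIDTH) — `A ⊆ W · D (j+1)` for every `j`;
* `commutator_sup_powClosure_eq_wordSet` — if some `D c = ⊥` and `l ⊆ U ⊇ Q ⊇ m`, then `A = W`.

[cite: DDMSAnalyticProP1999, Prop 1.19 (proof), Thm 1.17]
-/

namespace Literature.GroupTheory

open scoped Pointwise commutatorElement

variable {G : Type*} [Group G]

/-! ### The top layer -/

/-- **Top layer.** If `⁅Q, Q⁆ ≤ N₁` and `y ^ q ∈ N₁` for `y ∈ Q` (`N₁, Q` normal) and
`U ≤ ⟨entries of l⟩`, then `⁅Q, U⁆ ⊔ ⟨{y ^ q | y ∈ Q}⟩ ⊆ T(l, Q) · T(m, Q) · {y ^ q} · N₁`: modulo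
`N₁` every twisted commutator `⁅u, x⁆` is a product `⁅g₁, y₁⁆ ⋯ ⁅g_r, y_r⁆`.
[cite: DDMSAnalyticProP1999, Prop 1.19 (proof)] -/
theorem commutator_sup_powClosure_subset_wordSet_mul_of_le (N₁ : Subgroup G) [hN₁ : N₁.Normal]
    (Q : Subgroup G) [hQ : Q.Normal] (U : Subgroup G) (l m : List G) (q : ℕ)
    (hl : ∀ u ∈ U, u ∈ Subgroup.closure {a : G | a ∈ l}) (hQQ : ⁅Q, Q⁆ ≤ N₁)
    (hpow : ∀ y ∈ Q, y ^ q ∈ N₁) :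
    ((⁅Q, U⁆ ⊔ Subgroup.closure ((fun y : G => y ^ q) '' (Q : Set G)) : Subgroup G) : Set G) ⊆
      (l.map fun a => (fun y : G => ⁅a, y⁆) '' (Q : Set G)).prod *
        (m.map fun a => (fun y : G => ⁅a, y⁆) '' (Q : Set G)).prod *
        ((fun y : G => y ^ q) '' (Q : Set G)) * (N₁ : Set G) := by
  intro e he
  have hmbot : ∀ a ∈ m, ∀ b ∈ (⊥ : Subgroup G), ⁅a, b⁆ ∈ Q := by
    intro a _ b hb
    rw [Subgroup.mem_bot] at hb
    rw [hb, commutatorElement_one_right]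
    exact Q.one_mem
  -- every element of `A` is absorbed (with `K₁ = Q`, `K₂ = ⊥`)
  have key : ∃ s₁ ∈ (l.map fun a => (fun y : G => ⁅a, y⁆) '' (Q : Set G)).prod,
      ∃ s₂ ∈ (m.map fun a => (fun y : G => ⁅a, y⁆) '' ((⊥ : Subgroup G) : Set G)).prod,
        (QuotientGroup.mk e : G ⧸ N₁) = QuotientGroup.mk s₁ * QuotientGroup.mk s₂ := by
    have he' : e ∈ Subgroup.closure
        ({g | ∃ g₁ ∈ Q, ∃ g₂ ∈ U, ⁅g₁, g₂⁆ = g} ∪ (fun y : G => y ^ q) '' (Q : Set G)) := by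
      rw [Subgroup.closure_union, ← Subgroup.commutator_def]; exact he
    clear he
    induction he' using Subgroup.closure_induction with
    | mem z hz =>
      rcases hz with hz | hz
      · obtain ⟨x, hx, u, hu, rfl⟩ := hz
        rw [← commutatorElement_inv u x]
        exact exists_wordSet_mk_inv N₁ Q l m Q ⊥ hQQ le_rfl bot_le hmbot
          (exists_wordSet_mk_commutator_of_mem N₁ Q l m Q ⊥ hQQ le_rfl bot_le hmbot hl hu hx)
      · obtain ⟨y, hy, rfl⟩ := hz
        exact exists_wordSet_mk_of_mem N₁ l m Q ⊥ (hpow y hy)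
    | one => exact exists_wordSet_mk_one N₁ l m Q ⊥
    | mul z z' _ _ ih ih' => exact exists_wordSet_mk_mul N₁ Q l m Q ⊥ hQQ le_rfl bot_le hmbot ih ih'
    | inv z _ ih => exact exists_wordSet_mk_inv N₁ Q l m Q ⊥ hQQ le_rfl bot_le hmbot ih
  obtain ⟨s₁, hs₁, s₂, hs₂, hes⟩ := key
  have hs₂' : s₂ ∈ (m.map fun a => (fun y : G => ⁅a, y⁆) '' (Q : Set G)).prod :=
    wordSet_mono m (by intro b hb; rw [SetLike.mem_coe, Subgroup.mem_bot] at hb; rw [hb]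
                       exact Q.one_mem) hs₂
  refine Set.mem_mul.mpr ⟨s₁ * s₂ * (1 : G) ^ q, Set.mem_mul.mpr ⟨s₁ * s₂,
    Set.mem_mul.mpr ⟨s₁, hs₁, s₂, hs₂', rfl⟩, (1 : G) ^ q, ⟨1, Q.one_mem, rfl⟩, rfl⟩,
    (s₁ * s₂ * (1 : G) ^ q)⁻¹ * e, ?_, by group⟩
  rw [SetLike.mem_coe, ← QuotientGroup.eq, one_pow, mul_one, QuotientGroup.mk_mul, hes]

/-! ### The inductive step -/

/-- **Step.** Let `K₁ / N` be a layer central in `Q` (`⁅K₁, Q⁆ ≤ N`), with `K₁ ≤ K₂ ≤ Q` normal,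
`⁅a, b⁆ ∈ K₁` for `a` in `m`, `b ∈ K₂`, and `K₁ ≤ ⁅K₂, Q⁆ ⊔ ⟨{c ^ q | c ∈ K₂}⟩`; assume
`U ≤ ⟨entries of l⟩` and `Q ≤ ⟨U-conjugates of entries of m⟩`.  Then `W · K₁ ⊆ W · N`: a word
`t₁ t₂ y^q` times `e ∈ K₁` is rewritten, modulo `N`, as the word with corrected entries
`uᵢ ↦ uᵢkᵢ`, `zₖ ↦ zₖbₖ`, `y ↦ yc`. [cite: DDMSAnalyticProP1999, Prop 1.19 (proof)] -/
theorem wordSet_mul_subset_wordSet_mul (N : Subgroup G) [hN : N.Normal] (Q : Subgroup G)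
    [hQ : Q.Normal] (U : Subgroup G) (l m : List G) (K₁ K₂ : Subgroup G) [hK₁ : K₁.Normal]
    [hK₂ : K₂.Normal] (q : ℕ) (hK₁N : ⁅K₁, Q⁆ ≤ N) (hK₁Q : K₁ ≤ Q) (hK₂Q : K₂ ≤ Q)
    (hmK : ∀ a ∈ m, ∀ b ∈ K₂, ⁅a, b⁆ ∈ K₁)
    (hl : ∀ u ∈ U, u ∈ Subgroup.closure {a : G | a ∈ l})
    (hgen : ∀ x ∈ Q, x ∈ Subgroup.closure {z : G | ∃ u ∈ U, ∃ a ∈ m, z = u * a * u⁻¹})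
    (hK₁le : K₁ ≤ ⁅K₂, Q⁆ ⊔ Subgroup.closure ((fun c : G => c ^ q) '' (K₂ : Set G))) :
    (l.map fun a => (fun y : G => ⁅a, y⁆) '' (Q : Set G)).prod *
        (m.map fun a => (fun y : G => ⁅a, y⁆) '' (Q : Set G)).prod *
        ((fun y : G => y ^ q) '' (Q : Set G)) * (K₁ : Set G) ⊆
      (l.map fun a => (fun y : G => ⁅a, y⁆) '' (Q : Set G)).prod *
        (m.map fun a => (fun y : G => ⁅a, y⁆) '' (Q : Set G)).prod *
        ((fun y : G => y ^ q) '' (Q : Set G)) * (N : Set G) := by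
  rintro _ ⟨w, hw, e, he, rfl⟩
  obtain ⟨v, hv, _, ⟨y, hy, rfl⟩, rfl⟩ := Set.mem_mul.mp hw
  obtain ⟨t₁, ht₁, t₂, ht₂, rfl⟩ := Set.mem_mul.mp hv
  have hl₁ : ∀ a ∈ l, ∀ k ∈ (K₁ : Set G), ⁅a, k⁆ ∈ K₁ :=
    fun a _ k hk => commutatorElement_mem_of_normal K₁ a hk
  -- the power slot: `e ≡ c^q · g` with `g` absorbed
  obtain ⟨c, hc, g, hg, hge⟩ :=
    exists_pow_wordSet_mk_of_le N Q l m K₁ K₂ hK₁N hK₁Q hK₂Q hmK hl hgen q hK₁le he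
  obtain ⟨μ, hμ, hμeq⟩ := exists_mul_pow_eq_pow_mul Q K₂ q hy hc
  have hμS := exists_wordSet_mk_of_mem_commutator N Q l m K₁ K₂ hK₁N hK₁Q hK₂Q hmK hl hgen hμ
  obtain ⟨s₁, hs₁, s₂, hs₂, hsg⟩ := exists_wordSet_mk_mul N Q l m K₁ K₂ hK₁N hK₁Q hK₂Q hmK
    (exists_wordSet_mk_inv N Q l m K₁ K₂ hK₁N hK₁Q hK₂Q hmK hμS) hg
  -- merge the corrections into the `l`- and `m`-slots
  obtain ⟨t₁', ht₁', h₁⟩ := exists_mk_mul_mk_eq_of_mem_wordSet N Q hK₁N hl₁ hK₁Q le_rfl ht₁ hs₁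
  obtain ⟨t₂', ht₂', h₂⟩ := exists_mk_mul_mk_eq_of_mem_wordSet N Q hK₁N hmK hK₂Q le_rfl ht₂ hs₂
  have hycQ : (y * c) ^ q ∈ Q := Q.pow_mem (Q.mul_mem hy (hK₂Q hc)) q
  refine Set.mem_mul.mpr ⟨t₁' * t₂' * (y * c) ^ q, Set.mem_mul.mpr ⟨t₁' * t₂',
    Set.mem_mul.mpr ⟨t₁', ht₁', t₂', ht₂', rfl⟩, (y * c) ^ q, ⟨y * c, Q.mul_mem hy (hK₂Q hc), rfl⟩,
    rfl⟩, (t₁' * t₂' * (y * c) ^ q)⁻¹ * (t₁ * t₂ * y ^ q * e), ?_, by group⟩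
  rw [SetLike.mem_coe, ← QuotientGroup.eq]
  -- commutation facts modulo `N`
  have ht₂Q : t₂ ∈ Q := wordSet_subset_of_le m le_rfl ht₂
  have c₁ : ∀ x ∈ Q, (QuotientGroup.mk x : G ⧸ N) * QuotientGroup.mk s₁ =
      QuotientGroup.mk s₁ * QuotientGroup.mk x :=
    fun x hx => mk_mul_mk_comm_of_mem_wordSet N Q hK₁N hl₁ hs₁ hx
  have c₂ : ∀ x ∈ Q, (QuotientGroup.mk x : G ⧸ N) * QuotientGroup.mk s₂ =
      QuotientGroup.mk s₂ * QuotientGroup.mk x :=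
    fun x hx => mk_mul_mk_comm_of_mem_wordSet N Q hK₁N hmK hs₂ hx
  have eμ : (QuotientGroup.mk (y ^ q) : G ⧸ N) * QuotientGroup.mk (c ^ q) =
      QuotientGroup.mk ((y * c) ^ q) * (QuotientGroup.mk μ)⁻¹ := by
    rw [hμeq, QuotientGroup.mk_mul, QuotientGroup.mk_mul, mul_inv_cancel_right]
  have eg : (QuotientGroup.mk μ : G ⧸ N)⁻¹ * QuotientGroup.mk g =
      QuotientGroup.mk s₁ * QuotientGroup.mk s₂ := by
    rw [← hsg, QuotientGroup.mk_mul, QuotientGroup.mk_inv]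
  have comm₃ : (QuotientGroup.mk t₂ : G ⧸ N) * (QuotientGroup.mk ((y * c) ^ q) *
      (QuotientGroup.mk s₁ * QuotientGroup.mk s₂)) =
      QuotientGroup.mk s₁ * (QuotientGroup.mk t₂ * (QuotientGroup.mk s₂ *
        QuotientGroup.mk ((y * c) ^ q))) := by
    rw [← mul_assoc (QuotientGroup.mk ((y * c) ^ q) : G ⧸ N), c₁ _ hycQ, mul_assoc, c₂ _ hycQ,
      ← mul_assoc (QuotientGroup.mk t₂ : G ⧸ N), c₁ _ ht₂Q, mul_assoc]
  symm
  calc (QuotientGroup.mk (t₁ * t₂ * y ^ q * e) : G ⧸ N)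
      = QuotientGroup.mk t₁ * QuotientGroup.mk t₂ *
          (QuotientGroup.mk (y ^ q) * QuotientGroup.mk (c ^ q)) * QuotientGroup.mk g := by
        rw [QuotientGroup.mk_mul, QuotientGroup.mk_mul, QuotientGroup.mk_mul, hge]
        simp only [mul_assoc]
    _ = QuotientGroup.mk t₁ * (QuotientGroup.mk t₂ * (QuotientGroup.mk ((y * c) ^ q) *
          (QuotientGroup.mk s₁ * QuotientGroup.mk s₂))) := by
        rw [eμ]; simp only [mul_assoc]; rw [eg]
    _ = QuotientGroup.mk t₁ * QuotientGroup.mk s₁ * (QuotientGroup.mk t₂ * QuotientGroup.mk s₂) *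
          QuotientGroup.mk ((y * c) ^ q) := by
        rw [comm₃]; simp only [mul_assoc]
    _ = QuotientGroup.mk (t₁' * t₂' * (y * c) ^ q) := by
        rw [h₁, h₂, ← QuotientGroup.mk_mul, ← QuotientGroup.mk_mul]

/-! ### The lower `q`-central series (as a hypothesis on a sequence of subgroups) -/

/-- The subgroup generated by the `q`-th powers of a normal subgroup is normal.
[cite: DDMSAnalyticProP1999, §1.2] -/
theorem normal_closure_pow_image (K : Subgroup G) [hK : K.Normal] (q : ℕ) :
    (Subgroup.closure ((fun y : G => y ^ q) '' (K : Set G))).Normal := by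
  refine ⟨fun n hn g => ?_⟩
  induction hn using Subgroup.closure_induction with
  | mem z hz =>
    obtain ⟨y, hy, rfl⟩ := hz
    refine Subgroup.subset_closure ⟨g * y * g⁻¹, hK.conj_mem y hy g, ?_⟩
    show (g * y * g⁻¹) ^ q = g * y ^ q * g⁻¹
    exact conj_pow
  | one => rw [mul_one, mul_inv_cancel]; exact Subgroup.one_mem _
  | mul z z' _ _ ih ih' =>
    have : g * (z * z') * g⁻¹ = (g * z * g⁻¹) * (g * z' * g⁻¹) := by group
    rw [this]; exact Subgroup.mul_mem _ ih ih'
  | inv z _ ih =>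
    have : g * z⁻¹ * g⁻¹ = (g * z * g⁻¹)⁻¹ := by group
    rw [this]; exact Subgroup.inv_mem _ ih

section Series

variable (Q : Subgroup G) [hQ : Q.Normal] (q : ℕ) (D : ℕ → Subgroup G) (hD0 : D 0 = Q)
  (hDs : ∀ j, D (j + 1) = ⁅D j, Q⁆ ⊔ Subgroup.closure ((fun y : G => y ^ q) '' (D j : Set G)))
include hD0 hDs

/-- The terms of the lower `q`-central series lie in `Q`. [cite: DDMSAnalyticProP1999, §1.2] -/
theorem lowerPowSeries_le (j : ℕ) : D j ≤ Q := by
  induction j with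
  | zero => rw [hD0]
  | succ j ih =>
    rw [hDs]
    refine sup_le (Subgroup.commutator_le_right _ _) ?_
    rw [Subgroup.closure_le]
    rintro _ ⟨y, hy, rfl⟩
    exact Q.pow_mem (ih hy) q

/-- The terms of the lower `q`-central series are normal. [cite: DDMSAnalyticProP1999, §1.2] -/
theorem lowerPowSeries_normal (j : ℕ) : (D j).Normal := by
  induction j with
  | zero => rw [hD0]; exact hQ
  | succ j ih =>
    haveI := ih
    haveI := normal_closure_pow_image (D j) q
    rw [hDs]
    infer_instance

/-- The lower `q`-central series is decreasing. [cite: DDMSAnalyticProP1999, §1.2] -/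
theorem lowerPowSeries_succ_le (j : ℕ) : D (j + 1) ≤ D j := by
  haveI := lowerPowSeries_normal Q q D hD0 hDs j
  rw [hDs]
  refine sup_le (Subgroup.commutator_le_left _ _) ?_
  rw [Subgroup.closure_le]
  rintro _ ⟨y, hy, rfl⟩
  exact (D j).pow_mem hy q

/-- **Twisted commutator width modulo the lower `q`-central series.** For `Q ⊴ G`,
`U ≤ ⟨entries of l⟩`, `m ⊆ Q` with `Q ≤ ⟨U-conjugates of entries of m⟩`, and `D` the lower
`q`-central series of `Q` in `G`: for every `j`,
`⁅Q, U⁆ ⊔ ⟨{y ^ q | y ∈ Q}⟩ ⊆ T(l, Q) · T(m, Q) · {y ^ q | y ∈ Q} · D (j + 1)`.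
[cite: DDMSAnalyticProP1999, Prop 1.19 (proof)] -/
theorem commutator_sup_powClosure_subset_wordSet_mul (U : Subgroup G) (l m : List G)
    (hl : ∀ u ∈ U, u ∈ Subgroup.closure {a : G | a ∈ l}) (hm : ∀ a ∈ m, a ∈ Q)
    (hgen : ∀ x ∈ Q, x ∈ Subgroup.closure {z : G | ∃ u ∈ U, ∃ a ∈ m, z = u * a * u⁻¹}) (j : ℕ) :
    ((⁅Q, U⁆ ⊔ Subgroup.closure ((fun y : G => y ^ q) '' (Q : Set G)) : Subgroup G) : Set G) ⊆
      (l.map fun a => (fun y : G => ⁅a, y⁆) '' (Q : Set G)).prod *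
        (m.map fun a => (fun y : G => ⁅a, y⁆) '' (Q : Set G)).prod *
        ((fun y : G => y ^ q) '' (Q : Set G)) * (D (j + 1) : Set G) := by
  induction j with
  | zero =>
    haveI := lowerPowSeries_normal Q q D hD0 hDs (0 + 1)
    have h1 : D (0 + 1) = ⁅Q, Q⁆ ⊔ Subgroup.closure ((fun y : G => y ^ q) '' (Q : Set G)) := by
      rw [hDs 0, hD0]
    refine commutator_sup_powClosure_subset_wordSet_mul_of_le (D (0 + 1)) Q U l m q hl ?_ ?_
    · rw [h1]; exact le_sup_left
    · intro y hy
      rw [h1]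
      exact Subgroup.mem_sup_right (Subgroup.subset_closure ⟨y, hy, rfl⟩)
  | succ j ih =>
    haveI := lowerPowSeries_normal Q q D hD0 hDs j
    haveI := lowerPowSeries_normal Q q D hD0 hDs (j + 1)
    haveI := lowerPowSeries_normal Q q D hD0 hDs (j + 1 + 1)
    refine ih.trans (wordSet_mul_subset_wordSet_mul (D (j + 1 + 1)) Q U l m (D (j + 1)) (D j) q
      ?_ (lowerPowSeries_le Q q D hD0 hDs _) (lowerPowSeries_le Q q D hD0 hDs _) ?_ hl hgen ?_)
    · rw [hDs (j + 1)]; exact le_sup_left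
    · intro a ha b hb
      rw [hDs j, ← Subgroup.commutator_comm]
      exact Subgroup.mem_sup_left (Subgroup.commutator_mem_commutator (hm a ha) hb)
    · rw [hDs j]

/-- **Twisted commutator width.** If moreover some `D c = ⊥` (e.g. `Q` a finite `p`-group and
`p ∣ q`) and `l ⊆ U ⊇ Q`, then the ABSTRACT subgroup `⁅Q, U⁆ ⊔ ⟨{y ^ q | y ∈ Q}⟩` EQUALS the set
`T(l, Q) · T(m, Q) · {y ^ q | y ∈ Q}`: every element is `⁅g₁,u₁⁆⋯⁅g_r,u_r⁆ · ⁅x₁,z₁⁆⋯⁅x_s,z_s⁆ · y^q`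
with `uᵢ, zₖ, y ∈ Q`. [cite: DDMSAnalyticProP1999, Prop 1.19] -/
theorem commutator_sup_powClosure_eq_wordSet (U : Subgroup G) (l m : List G)
    (hlU : ∀ a ∈ l, a ∈ U) (hl : ∀ u ∈ U, u ∈ Subgroup.closure {a : G | a ∈ l})
    (hm : ∀ a ∈ m, a ∈ Q) (hQU : Q ≤ U)
    (hgen : ∀ x ∈ Q, x ∈ Subgroup.closure {z : G | ∃ u ∈ U, ∃ a ∈ m, z = u * a * u⁻¹}) {c : ℕ}
    (hc : D c = ⊥) :
    ((⁅Q, U⁆ ⊔ Subgroup.closure ((fun y : G => y ^ q) '' (Q : Set G)) : Subgroup G) : Set G) =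
      (l.map fun a => (fun y : G => ⁅a, y⁆) '' (Q : Set G)).prod *
        (m.map fun a => (fun y : G => ⁅a, y⁆) '' (Q : Set G)).prod *
        ((fun y : G => y ^ q) '' (Q : Set G)) := by
  refine Set.Subset.antisymm ?_ ?_
  · have h := commutator_sup_powClosure_subset_wordSet_mul Q q D hD0 hDs U l m hl hm hgen c
    have hbot : D (c + 1) = ⊥ := le_bot_iff.mp (hc ▸ lowerPowSeries_succ_le Q q D hD0 hDs c)
    rwa [hbot, Subgroup.coe_bot, Set.singleton_one, mul_one] at h
  · rintro _ ⟨_, ⟨t₁, ht₁, t₂, ht₂, rfl⟩, _, ⟨y, hy, rfl⟩, rfl⟩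
    refine Subgroup.mul_mem _ (Subgroup.mul_mem _ ?_ ?_) ?_
    · refine Subgroup.mem_sup_left ?_
      rw [Subgroup.commutator_comm]
      exact wordSet_subset_commutator l U Q hlU ht₁
    · refine Subgroup.mem_sup_left (Subgroup.commutator_mono le_rfl hQU ?_)
      exact wordSet_subset_commutator m Q Q hm ht₂
    · exact Subgroup.mem_sup_right (Subgroup.subset_closure ⟨y, hy, rfl⟩)

end Series

end Literature.GroupTheory
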